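import Literature.Analysis.FluidPDE.MikadoPipeGeometry
import Literature.Analysis.FluidPDE.MikadoDataIteration
import Literature.Analysis.FluidPDE.MikadoScales
import Literature.Analysis.FluidPDE.MikadoPhaseAverages
import Literature.Analysis.FluidPDE.NestedCutoffProducts
import Literature.Analysis.FunctionSpaces.TorusNestedCutoffs
import Mathlib.Analysis.Calculus.MeanValue
import HarnessLib

/-!
# The concrete inputs of the Coiculescu–Palasek iteration and their admissibility

Analysis/FluidPDE support file (definitions with proved API; no named facts) on the discharge path of
the principal-parts hypothesis `hA` of
`Literature.Barriers.NavierStokesRegularity.CriticalDataSmoothNonuniqueness_of_principalParts_of_perturbationLe`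
(M. P. Coiculescu, S. Palasek, Invent. Math. 244 (2025), arXiv:2503.14699, §2.4, Def. 3.1, Lemma 3.2,
Def. 3.4). This file instantiates the abstract inputs `CP25.IterData` of `MikadoDataIteration` with the
paper's choices for `γ = 2` and proves `CP25.IterData.Admissible` for them:

* profiles `φ_j = CP25.pipeFn j` (six pairwise disjoint pipes, `MikadoPipeGeometry`), constants
  `G_n = pipeDerivConst n`;
* unit phases `Λ_{j,k} = -i` (so `Re(Λ e_{Nη}) = sin(2πNη·x)`);
* averages `A_{j,k} = ∫ φ̃_j(M_k x)² sin²(2πN_kη_j·x) dx` (`CP25.phaseAvg`), with the uniform bounds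
  `bumpSqMass/4 ≤ A_{j,k} ≤ 1` once `a ≥ 4√3 G₁/bumpSqMass` (Lemma 3.2 (4): `A_{j,k} = ½∫φ̃_j² + O(M_k/N_k)`,
  from `abs_integral_mul_shearPhase_sq_sub_le`), where `bumpSqMass = ∫_{𝕋²} ρ² = ∫ φ̃_j²` > 0;
* scales `M_k = a^{b^k}`, `N_k = M_k²`, `ℓ_k = N_{k+1}^{-1/3}N_k^{-2/3}` (`MikadoScales`), `σ = 1/3 + 2/(3b)`
  (`ℓ_k⁻¹ = N_{k+1}^σ` EXACTLY, `M_k = N_{k+1}^{1/(2b)} ≤ N_{k+1}^σ`), lacunarity ratio `ρ = a^{2(b-1)}`;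
* cut-offs `χ_k = Torus.nestedCutoff pipeSet δ₁ M k` (`TorusNestedCutoffs`) with `δ₁ = pipeRadius = 10⁻⁶` and
  `cχ_n = 40 c̄_n / δ₁`;
* `CP25.inputConsts : IterConsts` (level- and scale-independent), `CP25.mkIter b a : IterData`,
  `(mkIter b a).cst = inputConsts` by `rfl`, and **`CP25.admissible_mkIter`**: `(mkIter b a).Admissible` for
  every integer `b ≥ 6` and every `a ≥ max 2 (4√3 G₁/bumpSqMass)`.

## Mathlib / tree search

Tree: `CP25.IterData`, `IterConsts`, `Admissible` (`MikadoDataIteration`), `CP25.pipeFn` & API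
(`MikadoPipeGeometry`), `scaleM/scaleN/scaleL` & API (`MikadoScales`), `abs_integral_mul_shearPhase_sq_sub_le`,
`shearPhase_sq_le` (`MikadoPhaseAverages`), `Torus.nestedCutoff`, `hasLiftDerivBounds_nestedCutoff_succ`
(`TorusNestedCutoffs`), `integral_comp_nsmul`, `proj_natCast_smul` (`ZerothLawProofs` via `NestedCutoffProducts`).
Mathlib: `Convex.norm_image_sub_le_of_norm_fderiv_le`, `Real.pow_rpow_inv_natCast`, `Real.rpow_natCast_mul`.

## References

* M. P. Coiculescu, S. Palasek, Invent. Math. 244 (2025) 165–219, doi:10.1007/s00222-025-01396-z,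
  arXiv:2503.14699: §2.4 (`M_k`, `N_k`, `γ`, `b`, `A`), Def. 3.1, Lemma 3.2 (4), Def. 3.4, Def. 3.5.
  [CoiculescuPalasek2025]
-/

noncomputable section

open MeasureTheory Set Function Real
open scoped BigOperators

namespace Literature.Analysis.FluidPDE

namespace CP25

open Literature.Analysis.FunctionSpaces Literature.Analysis.FunctionSpaces.Torus

/-! ## The profile mass and the level-independent constants -/

/-- `∫_{𝕋²} ρ²`, the common value of `∫ φ̃_j²`. [cite: CoiculescuPalasek2025, Lemma 3.2 (4)] -/
def bumpSqMass : ℝ := ∫ z : UnitAddTorus (Fin 2), pipeBump z ^ 2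

/-- `∫ φ̃_j² = ∫_{𝕋²} ρ²` (the straightening map is measure preserving). [cite: CoiculescuPalasek2025, Lemma 3.2 (4)] -/
theorem integral_pipeFn_sq (j : Fin 6) : ∫ y, pipeFn j y ^ 2 = bumpSqMass := by
  have h := integral_pipeProfile (nashDir j 0) (nashDir j 1) (ρ := fun z => pipeBump z ^ 2)
    ((isSmooth_pipeBump.continuous.pow 2).aestronglyMeasurable) (pipeCenter j)
  exact h

/-- `0 < ∫ ρ²` (`ρ = 1` on a ball). [folklore] -/
theorem bumpSqMass_pos : 0 < bumpSqMass := by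
  unfold bumpSqMass
  have hcont : Continuous fun z : UnitAddTorus (Fin 2) => pipeBump z ^ 2 := isSmooth_pipeBump.continuous.pow 2
  have hnn : 0 ≤ fun z : UnitAddTorus (Fin 2) => pipeBump z ^ 2 := fun z => sq_nonneg _
  refine (integral_pos_iff_support_of_nonneg hnn (hcont.integrable_of_hasCompactSupport
    (HasCompactSupport.of_compactSpace _))).2 ?_
  have hsub : Metric.ball (0 : UnitAddTorus (Fin 2)) pipeRadius ⊆ support fun z : UnitAddTorus (Fin 2) => pipeBump z ^ 2 := by
    intro z hz
    rw [mem_support, pipeBump_eq_one (Metric.mem_ball.1 hz), one_pow]; exact one_ne_zero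
  exact lt_of_lt_of_le (Metric.measure_ball_pos volume (0 : UnitAddTorus (Fin 2)) pipeRadius_pos) (measure_mono hsub)

/-- `bumpSqMass ≤ 1`. [folklore] -/
theorem bumpSqMass_le_one : bumpSqMass ≤ 1 := by
  unfold bumpSqMass
  have hint : Integrable (fun z : UnitAddTorus (Fin 2) => pipeBump z ^ 2) volume :=
    (isSmooth_pipeBump.continuous.pow 2).integrable_of_hasCompactSupport (HasCompactSupport.of_compactSpace _)
  calc ∫ z : UnitAddTorus (Fin 2), pipeBump z ^ 2 ≤ ∫ _z : UnitAddTorus (Fin 2), (1 : ℝ) :=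
        integral_mono hint (integrable_const _) fun z => by
          have h := pipeBump_mem_Icc z
          calc pipeBump z ^ 2 ≤ 1 ^ 2 := pow_le_pow_left₀ h.1 h.2 2
            _ = 1 := one_pow 2
    _ = 1 := by simp

/-- **The level-independent constants of the concrete inputs**: `G_n = pipeDerivConst n`,
`A₀ = bumpSqMass/4`, `cχ_n = 40 c̄_n/δ₁`. [cite: CoiculescuPalasek2025, §2.4] -/
def inputConsts : IterConsts where
  G := pipeDerivConst
  A₀ := bumpSqMass / 4
  cχ := fun n => 40 * derivProfileMassSup (Fin 3) n / pipeRadius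

/-- The phase averages `A_{j,k} = ∫ φ̃_j(M x)² Re(-i e_{Nη_j}(x))² dx`. [cite: CoiculescuPalasek2025, Lemma 3.2 (4) (l2normalizedpipes)] -/
def phaseAvg (M N : ℕ) (j : Fin 6) : ℝ :=
  ∫ x, pipeFn j (M • x) ^ 2 * shearPhase ((N : ℤ) • nashNormal j) (-Complex.I) x ^ 2

/-- The scale-separation exponent `σ = 1/3 + 2/(3b)`. [cite: CoiculescuPalasek2025, §2.4 with Def. 3.4] -/
def sigmaExp (b : ℕ) : ℝ := 1 / 3 + 2 / (3 * b)

/-- **The concrete inputs** for exponent base `b` and scale parameter `a` (`A = a` in §2.4, `γ = 2`).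
[cite: CoiculescuPalasek2025, §2.4, Def. 3.1, Def. 3.4, Def. 3.5] -/
def mkIter (b a : ℕ) : IterData where
  φ := pipeFn
  Λ := fun _ _ => -Complex.I
  A := fun k j => phaseAvg (scaleM a b k) (scaleN a b k) j
  χ := nestedCutoff pipeSet pipeRadius (scaleM a b)
  M := scaleM a b
  N := scaleN a b
  ℓ := scaleL a b
  cst := inputConsts
  σ := sigmaExp b
  ρ := (a : ℝ) ^ (2 * (b - 1))

/-- The constants of `mkIter b a` do not depend on `a`, `b`. [folklore] -/
theorem mkIter_cst (b a : ℕ) : (mkIter b a).cst = inputConsts := rfl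

/-! ## The phase averages: `bumpSqMass/4 ≤ A_{j,k} ≤ 1` -/

/-- `‖-i‖ = 1`. [folklore] -/
theorem norm_neg_I : ‖(-Complex.I : ℂ)‖ = 1 := by simp

/-- `A ≤ 1`. [cite: CoiculescuPalasek2025, Lemma 3.2 (4)] -/
theorem phaseAvg_le_one (M N : ℕ) (j : Fin 6) : phaseAvg M N j ≤ 1 := by
  unfold phaseAvg
  have hcont : Continuous fun x : UnitAddTorus (Fin 3) =>
      pipeFn j (M • x) ^ 2 * shearPhase ((N : ℤ) • nashNormal j) (-Complex.I) x ^ 2 :=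
    (((isSmooth_pipeFn j).continuous.comp (continuous_nsmul M)).pow 2).mul (continuous_shearPhase_sq _ _)
  have hint : Integrable (fun x : UnitAddTorus (Fin 3) =>
      pipeFn j (M • x) ^ 2 * shearPhase ((N : ℤ) • nashNormal j) (-Complex.I) x ^ 2) volume :=
    hcont.integrable_of_hasCompactSupport (HasCompactSupport.of_compactSpace _)
  calc (∫ x : UnitAddTorus (Fin 3), pipeFn j (M • x) ^ 2 * shearPhase ((N : ℤ) • nashNormal j) (-Complex.I) x ^ 2)
      ≤ ∫ _x : UnitAddTorus (Fin 3), (1 : ℝ) := integral_mono hint (integrable_const _) fun x => by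
        have h1 := pipeFn_mem_Icc j (M • x)
        have h2 := shearPhase_sq_le ((N : ℤ) • nashNormal j) (-Complex.I) x
        rw [norm_neg_I, one_pow] at h2
        have h3 : pipeFn j (M • x) ^ 2 ≤ 1 := by
          calc pipeFn j (M • x) ^ 2 ≤ 1 ^ 2 := pow_le_pow_left₀ h1.1 h1.2 2
            _ = 1 := one_pow 2
        calc pipeFn j (M • x) ^ 2 * shearPhase ((N : ℤ) • nashNormal j) (-Complex.I) x ^ 2 ≤ 1 * 1 :=
              mul_le_mul h3 h2 (sq_nonneg _) zero_le_one
          _ = 1 := one_mul 1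
    _ = 1 := by simp

/-- The lift of `φ̃_j` is `G₁`-Lipschitz. [folklore] -/
theorem norm_lift_pipeFn_sub_le (j : Fin 6) (y y' : EuclideanSpace ℝ (Fin 3)) :
    ‖lift (pipeFn j) y - lift (pipeFn j) y'‖ ≤ pipeDerivConst 1 * ‖y - y'‖ := by
  have hb := hasLiftDerivBounds_pipeFn 1 j
  have hdiff : ∀ x ∈ (univ : Set (EuclideanSpace ℝ (Fin 3))), DifferentiableAt ℝ (lift (pipeFn j)) x :=
    fun x _ => ((hb.contDiff.differentiable (by simp)) x)
  have hbound : ∀ x ∈ (univ : Set (EuclideanSpace ℝ (Fin 3))), ‖fderiv ℝ (lift (pipeFn j)) x‖ ≤ pipeDerivConst 1 := by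
    intro x _
    rw [← norm_iteratedFDeriv_zero (𝕜 := ℝ) (f := fderiv ℝ (lift (pipeFn j))) (x := x), norm_iteratedFDeriv_fderiv]
    have := hb.bound le_rfl x
    rwa [pow_one, mul_one] at this
  exact Convex.norm_image_sub_le_of_norm_fderiv_le hdiff hbound convex_univ (mem_univ y') (mem_univ y)

/-- **`bumpSqMass/4 ≤ A_{j,k}`** for `N = M²` and `M ≥ 4√3 G₁ / bumpSqMass` (Lemma 3.2 (4):
`|A - ½∫φ̃²| ≤ (2MG₁)(√3/N)/2 = √3 G₁/M`). [cite: CoiculescuPalasek2025, Lemma 3.2 (4)] -/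
theorem phaseAvg_ge {M : ℕ} (hM : 0 < M) (hMa : 4 * Real.sqrt 3 * pipeDerivConst 1 / bumpSqMass ≤ M) (j : Fin 6) :
    bumpSqMass / 4 ≤ phaseAvg M (M ^ 2) j := by
  have hN : 0 < M ^ 2 := pow_pos hM 2
  have hη : nashNormal j ≠ 0 := by
    intro h; have := congrFun h 0; simp at this
  set f : UnitAddTorus (Fin 3) → ℝ := fun x => pipeFn j (M • x) ^ 2 with hf
  have hG1 := pipeDerivConst_nonneg 1
  have hL : 0 ≤ 2 * (M : ℝ) * pipeDerivConst 1 := by positivity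
  have hfB : ∀ x, |f x| ≤ 1 := by
    intro x
    have h1 := pipeFn_mem_Icc j (M • x)
    rw [hf]; dsimp only
    rw [abs_of_nonneg (sq_nonneg _)]
    calc pipeFn j (M • x) ^ 2 ≤ 1 ^ 2 := pow_le_pow_left₀ h1.1 h1.2 2
      _ = 1 := one_pow 2
  have hfL : ∀ y y' : EuclideanSpace ℝ (Fin 3), |f (proj y) - f (proj y')| ≤ 2 * (M : ℝ) * pipeDerivConst 1 * ‖y - y'‖ := by
    intro y y'
    have e1 : f (proj y) = lift (pipeFn j) ((M : ℝ) • y) ^ 2 := by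
      rw [hf]; dsimp only; rw [lift_apply, proj_natCast_smul]
    have e2 : f (proj y') = lift (pipeFn j) ((M : ℝ) • y') ^ 2 := by
      rw [hf]; dsimp only; rw [lift_apply, proj_natCast_smul]
    rw [e1, e2, sq_sub_sq, abs_mul]
    have hsum : |lift (pipeFn j) ((M : ℝ) • y) + lift (pipeFn j) ((M : ℝ) • y')| ≤ 2 := by
      have h1 := abs_pipeFn_le_one j (proj ((M : ℝ) • y))
      have h2 := abs_pipeFn_le_one j (proj ((M : ℝ) • y'))
      rw [lift_apply, lift_apply]
      calc |pipeFn j (proj ((M : ℝ) • y)) + pipeFn j (proj ((M : ℝ) • y'))|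
          ≤ |pipeFn j (proj ((M : ℝ) • y))| + |pipeFn j (proj ((M : ℝ) • y'))| := abs_add_le _ _
        _ ≤ 2 := by linarith
    have hdiff : |lift (pipeFn j) ((M : ℝ) • y) - lift (pipeFn j) ((M : ℝ) • y')| ≤ pipeDerivConst 1 * ((M : ℝ) * ‖y - y'‖) := by
      have h := norm_lift_pipeFn_sub_le j ((M : ℝ) • y) ((M : ℝ) • y')
      rw [Real.norm_eq_abs, ← smul_sub, norm_smul, Real.norm_eq_abs, Nat.abs_cast] at h
      exact h
    calc |lift (pipeFn j) ((M : ℝ) • y) + lift (pipeFn j) ((M : ℝ) • y')| *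
          |lift (pipeFn j) ((M : ℝ) • y) - lift (pipeFn j) ((M : ℝ) • y')|
        ≤ 2 * (pipeDerivConst 1 * ((M : ℝ) * ‖y - y'‖)) :=
          mul_le_mul hsum hdiff (abs_nonneg _) (by norm_num)
      _ = 2 * (M : ℝ) * pipeDerivConst 1 * ‖y - y'‖ := by ring
  have h := abs_integral_mul_shearPhase_sq_sub_le (d := Fin 3) hN hη (-Complex.I) hL hfB hfL
  rw [norm_neg_I, one_pow, Fintype.card_fin] at h
  -- `∫ f = bumpSqMass`
  have hintf : ∫ x, f x = bumpSqMass := by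
    rw [hf]
    have hc : Continuous fun x : UnitAddTorus (Fin 3) => pipeFn j x ^ 2 := (isSmooth_pipeFn j).continuous.pow 2
    rw [show (fun x : UnitAddTorus (Fin 3) => pipeFn j (M • x) ^ 2) = fun x => (fun z => pipeFn j z ^ 2) (M • x) from rfl,
      integral_comp_nsmul hM hc.aestronglyMeasurable, integral_pipeFn_sq]
  rw [hintf] at h
  have hA : phaseAvg M (M ^ 2) j = ∫ x, f x * shearPhase (((M ^ 2 : ℕ) : ℤ) • nashNormal j) (-Complex.I) x ^ 2 := rfl
  rw [← hA] at h
  -- the error `2MG₁ · (√3/M²) · ½ = √3 G₁ / M ≤ bumpSqMass/4`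
  have hm := bumpSqMass_pos
  have hMr : (0 : ℝ) < M := by exact_mod_cast hM
  have herr : 2 * (M : ℝ) * pipeDerivConst 1 * (Real.sqrt (3 : ℕ) / ((M ^ 2 : ℕ) : ℝ)) * (1 / 2) ≤ bumpSqMass / 4 := by
    have hs : Real.sqrt (3 : ℕ) = Real.sqrt 3 := by norm_num
    rw [hs]
    push_cast
    have h3 : 0 ≤ Real.sqrt 3 := Real.sqrt_nonneg 3
    -- `√3 G₁ / M ≤ bumpSqMass / 4` from `4√3G₁/bumpSqMass ≤ M`
    have hkey : Real.sqrt 3 * pipeDerivConst 1 * 4 ≤ bumpSqMass * M := by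
      have := (div_le_iff₀ hm).1 hMa
      linarith
    rw [show 2 * (M : ℝ) * pipeDerivConst 1 * (Real.sqrt 3 / (M : ℝ) ^ 2) * (1 / 2) =
      Real.sqrt 3 * pipeDerivConst 1 / M by field_simp]
    rw [div_le_div_iff₀ hMr (by norm_num : (0:ℝ) < 4)]
    linarith
  have habs := (abs_sub_le_iff.1 h).2
  linarith

/-! ## Scale arithmetic for admissibility -/

section Scales

variable {a b : ℕ} (ha : 2 ≤ a) (hb : 4 ≤ b)
include ha hb

omit hb in
/-- `0 < N_k` in `ℝ`. [folklore] -/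
theorem scaleN_pos_real (k : ℕ) : (0 : ℝ) < scaleN a b k := by
  exact_mod_cast scaleN_pos (le_trans one_le_two ha) b k

omit hb in
/-- `1 ≤ N_k` in `ℝ`. [folklore] -/
theorem one_le_scaleN_real (k : ℕ) : (1 : ℝ) ≤ scaleN a b k := by
  exact_mod_cast one_le_scaleN (le_trans one_le_two ha) b k

omit ha hb in
/-- `N_{k+1} = N_k^b` in `ℝ`. [cite: CoiculescuPalasek2025, §2.4] -/
theorem scaleN_succ_real (k : ℕ) : (scaleN a b (k + 1) : ℝ) = (scaleN a b k : ℝ) ^ b := by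
  rw [scaleN_succ]; push_cast; rfl

/-- `N_k = N_{k+1}^{1/b}` in `ℝ`. [cite: CoiculescuPalasek2025, §2.4] -/
theorem scaleN_eq_rpow_succ (k : ℕ) : (scaleN a b k : ℝ) = (scaleN a b (k + 1) : ℝ) ^ ((b : ℝ)⁻¹) := by
  have hb0 : b ≠ 0 := by omega
  rw [scaleN_succ_real, Real.pow_rpow_inv_natCast (scaleN_pos_real ha k).le hb0]

/-- **`ℓ_k⁻¹ = N_{k+1}^σ`** with `σ = 1/3 + 2/(3b)`. [cite: CoiculescuPalasek2025, Def. 3.4 with §2.4] -/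
theorem inv_scaleL_eq (k : ℕ) : (scaleL a b k)⁻¹ = (scaleN a b (k + 1) : ℝ) ^ sigmaExp b := by
  have h0 := scaleN_pos_real ha (b := b) k
  have h1 := scaleN_pos_real ha (b := b) (k + 1)
  have hbpos : (0 : ℝ) < b := by exact_mod_cast (show 0 < b by omega)
  unfold scaleL sigmaExp
  rw [mul_inv, Real.rpow_neg h1.le, Real.rpow_neg h0.le, inv_inv, inv_inv, scaleN_eq_rpow_succ ha hb k,
    ← Real.rpow_mul h1.le, ← Real.rpow_add h1]
  congr 1
  field_simp

/-- `M_k = N_{k+1}^{1/(2b)}`. [cite: CoiculescuPalasek2025, §2.4] -/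
theorem scaleM_eq_rpow (k : ℕ) : (scaleM a b k : ℝ) = (scaleN a b (k + 1) : ℝ) ^ (1 / (2 * (b : ℝ))) := by
  have h1 := scaleN_pos_real ha (b := b) (k + 1)
  have hM0 : (0 : ℝ) ≤ scaleM a b k := Nat.cast_nonneg _
  have hMsq : (scaleM a b k : ℝ) = (scaleN a b k : ℝ) ^ ((2 : ℕ) : ℝ)⁻¹ := by
    rw [show (scaleN a b k : ℝ) = (scaleM a b k : ℝ) ^ 2 by rw [scaleN]; push_cast; rfl,
      Real.pow_rpow_inv_natCast hM0 two_ne_zero]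
  rw [hMsq, scaleN_eq_rpow_succ ha hb k, ← Real.rpow_mul h1.le]
  congr 1
  push_cast
  field_simp

/-- **`M_k ≤ N_{k+1}^σ`** (`1/(2b) ≤ σ`). [cite: CoiculescuPalasek2025, §2.4] -/
theorem scaleM_le_rpow (k : ℕ) : (scaleM a b k : ℝ) ≤ (scaleN a b (k + 1) : ℝ) ^ sigmaExp b := by
  rw [scaleM_eq_rpow ha hb k]
  refine Real.rpow_le_rpow_of_exponent_le (one_le_scaleN_real ha (k + 1)) ?_
  unfold sigmaExp
  have hbpos : (0 : ℝ) < b := by exact_mod_cast (show 0 < b by omega)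
  rw [div_le_iff₀ (by positivity)]
  have : (1 / 3 + 2 / (3 * (b : ℝ))) * (2 * b) = 2 * b / 3 + 4 / 3 := by field_simp; ring
  rw [this]
  have hb1 : (1 : ℝ) ≤ b := by exact_mod_cast (show 1 ≤ b by omega)
  linarith

omit ha in
/-- `0 ≤ σ`. [folklore] -/
theorem sigmaExp_nonneg : 0 ≤ sigmaExp b := by unfold sigmaExp; positivity

omit ha in
/-- `σ ≤ 1/2` for `b ≥ 4`. [cite: CoiculescuPalasek2025, §2.4] -/
theorem sigmaExp_le_half : sigmaExp b ≤ 1 / 2 := by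
  unfold sigmaExp
  have hb4 : (4 : ℝ) ≤ b := by exact_mod_cast hb
  have hbpos : (0 : ℝ) < b := by linarith
  rw [div_add_div _ _ (by norm_num : (3:ℝ) ≠ 0) (by positivity), div_le_div_iff₀ (by positivity) (by norm_num)]
  nlinarith

/-- **`4 M_m ≤ M_{m+1}`** (the dilations are lacunary enough for the nested cut-offs). [cite: CoiculescuPalasek2025, §2.4] -/
theorem four_mul_scaleM_le_succ (m : ℕ) : 4 * scaleM a b m ≤ scaleM a b (m + 1) := by
  rw [scaleM_succ]
  have hM : 2 ≤ scaleM a b m := le_trans ha (le_scaleM (le_trans one_le_two ha) (by omega) m)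
  have hpow : scaleM a b m ^ b = scaleM a b m ^ (b - 1) * scaleM a b m := by
    rw [← pow_succ]; congr 1; omega
  rw [hpow]
  have h4 : 4 ≤ scaleM a b m ^ (b - 1) := by
    calc 4 = 2 ^ 2 := by norm_num
      _ ≤ scaleM a b m ^ 2 := Nat.pow_le_pow_left hM 2
      _ ≤ scaleM a b m ^ (b - 1) := Nat.pow_le_pow_right (by omega) (by omega)
  calc 4 * scaleM a b m ≤ scaleM a b m ^ (b - 1) * scaleM a b m := Nat.mul_le_mul_right _ h4
    _ = scaleM a b m ^ (b - 1) * scaleM a b m := rfl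

/-- **Lacunarity `a^{2(b-1)} N_k ≤ N_{k+1}`** (`N_{k+1}/N_k = N_k^{b-1} ≥ (a²)^{b-1}`). [cite: CoiculescuPalasek2025, proof of Prop. 3.13] -/
theorem rho_mul_scaleN_le (k : ℕ) : (a : ℝ) ^ (2 * (b - 1)) * scaleN a b k ≤ scaleN a b (k + 1) := by
  have hnat : a ^ (2 * (b - 1)) * scaleN a b k ≤ scaleN a b (k + 1) := by
    rw [scaleN_succ]
    have hpow : scaleN a b k ^ b = scaleN a b k ^ (b - 1) * scaleN a b k := by
      rw [← pow_succ]; congr 1; omega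
    rw [hpow]
    refine Nat.mul_le_mul_right _ ?_
    rw [pow_mul]
    exact Nat.pow_le_pow_left (sq_le_scaleN (le_trans one_le_two ha) (by omega) k) _
  exact_mod_cast hnat

/-- `2 ≤ a^{2(b-1)}`. [folklore] -/
theorem two_le_rho : (2 : ℝ) ≤ (a : ℝ) ^ (2 * (b - 1)) := by
  have hnat : 2 ≤ a ^ (2 * (b - 1)) :=
    le_trans ha (by
      calc a = a ^ 1 := (pow_one a).symm
        _ ≤ a ^ (2 * (b - 1)) := Nat.pow_le_pow_right (by omega) (by omega))
  exact_mod_cast hnat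

end Scales

/-! ## Admissibility of the concrete inputs -/

/-- **The concrete inputs are admissible** for `b ≥ 4` and `a ≥ max 2 (4√3 G₁ / bumpSqMass)`.
[cite: CoiculescuPalasek2025, §2.4, Def. 3.1, Lemma 3.2, Def. 3.4] -/
theorem admissible_mkIter {b a : ℕ} (hb : 4 ≤ b) (ha : 2 ≤ a)
    (haA : 4 * Real.sqrt 3 * pipeDerivConst 1 / bumpSqMass ≤ a) : (mkIter b a).Admissible where
  profile n j := hasLiftDerivBounds_pipeFn n j
  phase k j := by show ‖(-Complex.I : ℂ)‖ ≤ 1; rw [norm_neg_I]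
  A₀_pos := by show 0 < bumpSqMass / 4; have := bumpSqMass_pos; positivity
  average k j := by
    show bumpSqMass / 4 ≤ phaseAvg (scaleM a b k) (scaleN a b k) j
    have hM : 0 < scaleM a b k := one_le_scaleM (le_trans one_le_two ha) b k
    have hMa : 4 * Real.sqrt 3 * pipeDerivConst 1 / bumpSqMass ≤ scaleM a b k :=
      haA.trans (by exact_mod_cast le_scaleM (le_trans one_le_two ha) (by omega) k)
    exact phaseAvg_ge hM hMa j
  cutoff n k := by
    show HasLiftDerivBounds n (nestedCutoff pipeSet pipeRadius (scaleM a b) (k + 1)) 1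
      (40 * derivProfileMassSup (Fin 3) n / pipeRadius * scaleM a b k)
    have h := hasLiftDerivBounds_nestedCutoff_succ pipeRadius_pos (pipeRadius_le.trans (by norm_num))
      (P := pipeSet) (M := scaleM a b) (four_mul_scaleM_le_succ ha hb) n k
    refine h.mono le_rfl ?_ (le_of_eq (by ring))
    have := one_le_derivProfileMassSup (d := Fin 3) n; have := pipeRadius_pos; positivity
  cχ_nonneg n := by
    show 0 ≤ 40 * derivProfileMassSup (Fin 3) n / pipeRadius
    have := one_le_derivProfileMassSup (d := Fin 3) n; have := pipeRadius_pos; positivity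
  M_le_N k := scaleM_le_scaleN (le_trans one_le_two ha) b k
  M_le_N_succ k := (scaleM_le_scaleN (le_trans one_le_two ha) b k).trans (scaleN_le_succ ha (by omega) k)
  one_le_N k := one_le_scaleN (le_trans one_le_two ha) b k
  ℓ_pos k := scaleL_pos ha k
  ℓ_le k := scaleL_le_quarter ha (by omega) k
  ℓ_N k := one_le_scaleL_mul_scaleN_succ ha (by omega) k
  A_le_one k j := phaseAvg_le_one _ _ j
  σ_nonneg := sigmaExp_nonneg hb
  σ_le_half := sigmaExp_le_half hb
  inv_ℓ_le_rpow k := le_of_eq (inv_scaleL_eq ha hb k)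
  M_le_rpow k := scaleM_le_rpow ha hb k
  two_le_ρ := two_le_rho ha hb
  ρ_lacunary k := rho_mul_scaleN_le ha hb k

end CP25

end Literature.Analysis.FluidPDE
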